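import Summits.QuantumAdvantage.QuantumAdvantage.Theses.DWalkThree
import HarnessLib

/-!
# Route DWalkThree, `Assembly` (stmt-QuantumAdvantage-22488): R0 → THEOREM A → dense residual → the `p = 3` rung leaf

Pure logic over two landed theorems: from `RingFixedBellsSharp3`, `RingBShot3` and the sharp dense residual
`RingDenseResidual3 : RingFixedBellsSharp3 → RingBShot3 → RingTwoThirds3` we get the `2/3 + ε` law `RingTwoThirds3`; at `ε = 1/6`
this is `RingHardOdd 3` with `θ = 5/6`; the tree's `ringHardOfOdd 3` (give away the even class) and
`Theorems.adviceFreeQNC0Sep_of_ringHard 3` (Razborov–Smolensky + BGK) give the leaf `AdviceFreeQNC0Sep 3`.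
(The same `θ = 5/6` step shows that the sharp aside `RingDenseResidual3` implies the load-bearing crux `RingDenseResidualLt3`.)
WHAT THIS IS NOT: no item hypothesis is proved here (R0, THEOREM A and the dense residual are open); rung F-Q2-odd3 bookkeeping only;
separation NOT moved.
-/

set_option linter.dupNamespace false

namespace Summit.QuantumAdvantage.QuantumAdvantage.Theorems

open Summit.QuantumAdvantage.QuantumAdvantage.Theses.DWalkThree

/-- The `2/3 + ε` law on the odd class at `ε = 1/6` is `RingHardOdd 3` (`θ = 5/6`). -/
theorem dWalkThree_ringHardOdd_of_twoThirds (h : RingTwoThirds3) :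
    Summit.QuantumAdvantage.AdviceFreeQNC0.RingHardOdd 3 := by
  refine ⟨5 / 6, by norm_num, fun c => ?_⟩
  obtain ⟨n₀, hn₀⟩ := h (1 / 6) (by norm_num) c
  refine ⟨n₀, fun n hn P hP => ?_⟩
  have h' := hn₀ n hn P hP
  have h56 : (2 / 3 + 1 / 6 : ℝ) = 5 / 6 := by norm_num
  rw [h56] at h'
  convert h' using 2

/-- **`Assembly` — PROVED**: `RingFixedBellsSharp3 → RingBShot3 → RingDenseResidual3 → AdviceFreeQNC0Sep 3`. -/
theorem dWalkThree_assembly : Summit.QuantumAdvantage.QuantumAdvantage.Theses.DWalkThree.Assembly := by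
  unfold Assembly
  intro hR0 hA hD
  exact Summit.QuantumAdvantage.QuantumAdvantage.Theorems.adviceFreeQNC0Sep_of_ringHard 3
    (Summit.QuantumAdvantage.AdviceFreeQNC0.ringHardOfOdd 3 (dWalkThree_ringHardOdd_of_twoThirds (hD hR0 hA)))

end Summit.QuantumAdvantage.QuantumAdvantage.Theorems
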